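import Summits.ABC.ABC.Theses.IsogenyGlueCongruence
import Literature.NumberTheory.DiophantineGeometry.GaudronRemondEllipticPairs
import Literature.NumberTheory.DiophantineGeometry.ValuationProductElliptic
import Literature.NumberTheory.DiophantineGeometry.FaltingsHeight

/-!
# Crux-ideate sketch — stmt-ABC-10895 `SharpDegreeOfPolyDegree` (round 1, ideator 1)

Statements only (first lemmas of the crux idea card `stratum-log-height-regime`), plus the
one-line reduction `StratifiedDegreeConjecture → SharpDegreeOfPolyDegree` (proved).
Nothing here is filed as a route item; the crux is fixed.
-/

noncomputable section

namespace Summit.ABC.ABC.Cruxes.SharpDegreeOfPolyDegree.Ideas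

open Summit.ABC.ABC.Theses.IsogenyGlueCongruence
open Literature.NumberTheory.EllipticCurves.ModularForms (ModularParametrizationData)
open Literature.NumberTheory.DiophantineGeometry

/-- `PolyAt κ C W`: the curve `W` has a modular parametrisation datum at level `N = N_W` of degree
`≤ C · N^κ` — the pointwise form of the antecedent of R. -/
def PolyAt (κ C : ℝ) (W : WeierstrassCurve ℚ) [W.IsElliptic] [NeZero (W.conductorNorm ℤ)] : Prop :=
  ∃ D : ModularParametrizationData W (W.conductorNorm ℤ),
    (D.modularDegree : ℝ) ≤ C * (W.conductorNorm ℤ : ℝ) ^ κ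

/-- The antecedent `Poly` of R, verbatim up to `PolyAt`. -/
def PolyDegree : Prop :=
  ∃ κ C : ℝ, ∀ (W : WeierstrassCurve ℚ) [W.IsElliptic] [W.IsGloballyMinimal]
    [NeZero (W.conductorNorm ℤ)], W.IsSemistable ℤ → PolyAt κ C W

/-- STRATUM CONDITION at a conductor: every semistable globally-minimal elliptic `W'` whose
conductor DIVIDES `N_W` is `(κ, C)`-polynomial.  Under `Poly(κ, C)` every `W` is on the stratum;
without the global hypothesis it is a per-conductor condition (the only way R's hypothesis is ever
used by a height-polynomial tool: on `W` itself and on partners of level dividing `N`). -/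
def OnStratum (κ C : ℝ) (W : WeierstrassCurve ℚ) : Prop :=
  ∀ (W' : WeierstrassCurve ℚ) [W'.IsElliptic] [W'.IsGloballyMinimal] [NeZero (W'.conductorNorm ℤ)],
    W'.IsSemistable ℤ → W'.conductorNorm ℤ ∣ W.conductorNorm ℤ → PolyAt κ C W'

/-- TRANSFER `C⁺`: the sharp modular-degree conjecture STRATUM BY STRATUM — for each `(κ, C)` and
`ε > 0` a constant `C'(κ, C, ε)` serving every semistable curve whose conductor-stratum is
`(κ, C)`-polynomial.  Weaker than `SemistableDegreeConjecture` (constants may depend on the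
stratum), and `C⁺ → R` is one line (`sharpDegreeOfPolyDegree_of_stratified`). -/
def StratifiedDegreeConjecture : Prop :=
  ∀ κ C : ℝ, ∀ ε : ℝ, 0 < ε → ∃ C' : ℝ, ∀ (W : WeierstrassCurve ℚ) [W.IsElliptic]
    [W.IsGloballyMinimal] [NeZero (W.conductorNorm ℤ)], W.IsSemistable ℤ → OnStratum κ C W →
      ∃ D : ModularParametrizationData W (W.conductorNorm ℤ),
        (D.modularDegree : ℝ) ≤ C' * (W.conductorNorm ℤ : ℝ) ^ (2 + ε)

/-- `C⁺ → R`: given the global polynomial bound, every curve lies on the stratum `(κ, C)`. -/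
theorem sharpDegreeOfPolyDegree_of_stratified (h : StratifiedDegreeConjecture) :
    SharpDegreeOfPolyDegree := by
  rintro ⟨κ, C, hP⟩ ε hε
  obtain ⟨C', hC'⟩ := h κ C ε hε
  exact ⟨C', fun W _ _ _ hW => hC' W hW (fun W' _ _ _ hW' _ => hP W' hW')⟩

/-- DICTIONARY FACT (degree ⇒ height; provable from Zagier's formula `deg · covol = 4π²c²(f,f)`
(PROVED in tree), `c ∈ ℤ ∖ {0}`, the trivial lower bound for `(f,f)` of a normalised newform and
`h_F = −½ log covol` (`faltingsHeight_eq_neg_half_log_covolume`); semistable ⇒ stable = unstable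
height): a datum of degree `d` forces `h_F(W) ≤ ½ log d + 6`. -/
def HeightLeOfDegree : Prop :=
  ∀ (W : WeierstrassCurve ℚ) [W.IsElliptic] [W.IsGloballyMinimal] (N : ℕ) [NeZero N]
    (D : ModularParametrizationData W N), W.IsSemistable ℤ →
      W.stableFaltingsHeight ≤ (1 / 2) * Real.log D.modularDegree + 6

/-- FIRST LEMMA (L1) — POLYLOG TORSION SHARING in the log-height regime: on a `(κ, C)`-stratum,
two NON-isogenous semistable curves of conductor dividing `N` can share their `ℓ`-torsion
Galois-equivariantly only for `ℓ ≤ C₀ · (1 + log N)^4`.  (From the vendored pair form of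
Gaudron–Rémond 2023, `ℓ ≤ B(E,E')⁴` with `B` linear in `h_F(E) + h_F(E')`, and
`HeightLeOfDegree` on both curves: `h_F ≤ (κ/2) log N + ½ log C + 6`.) -/
def PolylogTorsionSharing : Prop :=
  ∀ κ C : ℝ, ∃ C₀ : ℝ, ∀ (W : WeierstrassCurve ℚ) [W.IsElliptic] [W.IsGloballyMinimal]
    [NeZero (W.conductorNorm ℤ)], W.IsSemistable ℤ → OnStratum κ C W →
    ∀ (W' : WeierstrassCurve ℚ) [W'.IsElliptic] [W'.IsGloballyMinimal]
      [NeZero (W'.conductorNorm ℤ)], W'.IsSemistable ℤ →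
      W'.conductorNorm ℤ ∣ W.conductorNorm ℤ → ¬ W.IsIsogenous W' →
      ∀ ℓ : ℕ, ℓ.Prime →
        (∃ e : W.geomTorsion ℓ ≃+ W'.geomTorsion ℓ,
            ∀ (σ : Field.absoluteGaloisGroup ℚ) (P : W.geomTorsion ℓ), e (σ • P) = σ • e P) →
        (ℓ : ℝ) ≤ C₀ * (1 + Real.log (W.conductorNorm ℤ)) ^ 4

/-- Intended derivation of L1 (to be proved at crux-plan stage; the two hypotheses are a vendored
named fact and the dictionary fact above). -/
theorem polylogTorsionSharing_of (hGR : GaudronRemond2023_torsionHom_ellipticPair)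
    (hH : HeightLeOfDegree) : PolylogTorsionSharing := by
  sorry

/-- FIRST LEMMA (L2) — AUXILIARY PRIME OF LOGARITHMIC SIZE: on the stratum there is a prime
`11 ≤ ℓ ≤ C₁ (1 + log N)` exceeding every exponent `v_p(Δ_min)` and dividing none of them (so
`ρ̄_{E,ℓ}` is irreducible (Mazur), ramified at every `p ∣ N` (Tate), of Serre conductor exactly
`N`: `f_E mod ℓ` admits NO level-lowering).  (From `PolyAt` + `HeightLeOfDegree` + Silverman's
`log|Δ_min| < 12 h + 16` the exponents are `O(κ log N)`; Pasten's product theorem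
`∏ v_p < K_ε N^{11/2+ε}` bounds the number of their prime factors above that size by
`O(log N / log log N)`; Chebyshev supplies more primes than that below `C₁ log N`.) -/
def AuxiliaryLogPrime : Prop :=
  ∀ κ C : ℝ, ∃ C₁ : ℝ, ∀ (W : WeierstrassCurve ℚ) [W.IsElliptic] [W.IsGloballyMinimal]
    [NeZero (W.conductorNorm ℤ)], W.IsSemistable ℤ → PolyAt κ C W →
      ∃ ℓ : ℕ, ℓ.Prime ∧ 11 ≤ ℓ ∧ (ℓ : ℝ) ≤ C₁ * (1 + Real.log (W.conductorNorm ℤ)) ∧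
        ∀ p ∈ (W.conductorNorm ℤ).primeFactors,
          (W.minimalDiscriminantNorm ℤ).factorization p < ℓ ∧
            ¬ ℓ ∣ (W.minimalDiscriminantNorm ℤ).factorization p

/-- Intended derivation of L2 (crux-plan stage). -/
theorem auxiliaryLogPrime_of (hP : pastenShimura2024_thm_1_12) (hH : HeightLeOfDegree)
    (hS : WeierstrassCurve.log_minimalDiscriminantNorm_lt_faltingsHeight) : AuxiliaryLogPrime := by
  sorry

end Summit.ABC.ABC.Cruxes.SharpDegreeOfPolyDegree.Ideas

end
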